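import Mathlib
import HarnessLib
import HarnessLib.Audit
import Summits.HodgeConjecture.HodgeConjecture.Theses.IncidenceNodePeeling
import Literature.AlgebraicGeometry.HodgeTheory.IsoTransport
import Literature.AlgebraicGeometry.HodgeTheory.GlobalInvariantCycles
import Literature.AlgebraicGeometry.HodgeTheory.AlgebraicityLocus

/-!
# Line `local_anchor` — alternative skeleton for the crux `HCMovablePairs` (stmt-HodgeConjecture-2348)

Route `IncidenceNodePeeling` (route-HodgeConjecture-IncidenceNodePeeling), crux `HCMovablePairs` (rank 5): a rational
`(p,p)`-class `ζ` on a smooth degree-`d` hypersurface `X ⊂ ℙ^{2p+1}_ℂ` whose pair `(X, ζ)` is MOVABLE is algebraic.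
Registered ALONGSIDE the live skeleton `Lines/birth.lean` (never over it) by the crux-strategist seat
`planner-cstrat-stmt-HodgeConjecture-2348-s2-0`, 2026-08-17.

THE LINE = ANCHOR + LOCAL VARIATIONAL HODGE + BAIRE PROPAGATION. It is the re-cut of `birth`
(nodal exhaustion) in which every stub is weakened to what the composition actually consumes:

* `stub_anchorOnHodgeLocusFamily : AnchorOnHodgeLocusFamily` — ANCHOR GEOGRAPHY: every movable pair `(X, ζ)` lies on a
  smooth projective family `g : 𝒴 ⟶ T` of smooth degree-`d` hypersurfaces over a smooth irreducible quasi-projective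
  base, carrying a global class `Θ` that is fibrewise rational of type `(p,p)`, with `𝒴_{t₂} ≅ X`, `Θ|_{t₂} = e₂^* ζ`,
  and ONE fibre `𝒴_{t₁}`, NOT isomorphic to `X`, on which `Θ|_{t₁}` is algebraic. Any anchor source is admissible
  (Fermat / Shioda members, members containing linear or complete-intersection subvarieties, CM members, the nearby
  fibre of a nodal degeneration as in `birth`): `birth`'s stubs 1 ∧ 2 imply it, not conversely.
* `stub_localVariationalHodge : LocalVariationalHodge` — Grothendieck's variational Hodge statement for hypersurface
  families in its LOCAL form: an algebraic fibre `t₁` has an analytic-open neighbourhood of algebraic fibres. It is the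
  `k = 0`, local-output case of the route's own `ReturnAlongHodgeLocus` (stmt-13854) and is implied by `birth`'s stub 3
  (`PropagationAlongHodgeLocus`, global form) with `N = univ`; it is a THEOREM when the anchor class is the Chern
  character of a semiregular sheaf / the class of a semiregular lci or complete-intersection subvariety (Bloch 1972
  Thm 7.3; Buchweitz–Flenner 2003 Thm 5.1 = tree fact `BuchweitzFlenner2003_variationalHodge_semiregular`; Dan 2014,
  Kloosterman 2021 for complete intersections in hypersurfaces).
* `stub_openAnchorPropagates : OpenAnchorPropagates` — KNOWN THEOREM (no Hodge theory in it): for a smooth projective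
  family over a smooth irreducible quasi-projective base, if a global class is algebraic on the fibres over a non-empty
  analytic-open set of the base, it is algebraic on every fibre. Proof in print: the algebraicity locus is a countable
  union of Zariski-closed subsets (Charles–Schnell 2014 Prop. 11.3.11 = tree named fact
  `charlesSchnell_algebraicityLocus_iUnion_closed`); by Baire one of them has non-empty analytic interior, hence (base
  irreducible) is the whole base.
* `HCMovablePairs_of : AnchorOnHodgeLocusFamily → LocalVariationalHodge → OpenAnchorPropagates → HCMovablePairs` —
  the skeleton theorem, a REAL proof (no sorry): anchor `t₁` ⟹ open set of algebraic fibres (stub 2) ⟹ every fibre,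
  in particular `t₂` (stub 3) ⟹ `Θ|_{t₂} = e₂^*ζ` and iso-transport (`mem_algebraicClasses_map_iff_of_iso`).
  `HCMovablePairs_of_stubs : HCMovablePairs` instantiates it with the three stubs.

Why this is a different line from `birth` (and what it dodges): `birth` needs (1) a SUPPORTED NODAL DEGENERATION inside
the Hodge locus, (2) RETURN ACROSS THE NODES (⊇ local VHC) and (3) GLOBAL VHC along hypersurface families. Here (3) is
replaced by the known countability + Baire statement (stub 3) plus the LOCAL VHC at ONE anchor of our choosing (stub 2,
weaker than both (2) and (3)), and (1) ∧ (2) by plain anchor existence (stub 1). The open content is therefore exactly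
{anchor geography on movable Hodge-locus families} ∪ {local VHC at that anchor}, and a prover may pick the anchor where
local VHC is already a theorem (semiregular / complete-intersection representatives).

Honest status. Stub 3 is a theorem in print (formalisation debt: the named fact + Baire on `T(ℂ)` + "a proper closed
subset of an irreducible variety has empty analytic interior"). Stub 2 is open in general (= local VHC; Bloch–Esnault–Kerz
2014 give the formal half, algebraisation is the gap), known for semiregular anchors. Stub 1 is the crux's geography and
carries its hardness: by the THICKENING LEMMA of this seat's STRATEGY-CENSUS.md §Negation (Shioda's inductive structure
for `F(x) + G(u,v)`), movable pairs include Sebastiani–Thom thickenings of RIGID pairs of dimension `2p − 2`, on whose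
Hodge-locus family every anchor is worth HC for the rigid seed; no typed excision removes this (same phenomenon as the
`AnchorExistence` disguise lemma). All three stubs are implied by HC; none implies the crux or the summit cheaply (BC3
probes, seat folder `bc/`).

Disproof used: `Cruxes/HCMovablePairs/` has no `Disproof.lean`, no `_false_without_` theorem, no landed
`Theorems/HCMovablePairs/Negative/*` (2026-08-17, `ledger crux ls`). For the SHAPE of stubs 1–2 the standing analysis
`Cruxes/VariationalHodge/Disproof.lean` applies and is honoured: the anchor is load-bearing (stub 2 keeps the anchor
hypothesis; stub 1 manufactures it); base irreducible (stub 3 is false on a reducible base — irreducibility kept).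
Negatives index (`ledger negatives --problem HodgeConjecture`, 3 entries: stmt-17744, stmt-11121, stmt-12555): no stub is
an instance.
-/

set_option linter.dupNamespace false
set_option linter.unusedVariables false

namespace Summit.HodgeConjecture.HodgeConjecture.Cruxes.HCMovablePairs.LocalAnchor

open scoped BigOperators

/-! ## §1 The stub STATEMENTS (named Props, fully qualified so a prover can restate them verbatim) -/

/-- **Statement of stub 1 — an anchor on a Hodge-locus family through `X` (ANCHOR GEOGRAPHY).** For every MOVABLE
pair `(X, ζ)` (hypotheses verbatim those of `HCMovablePairs`) there are a smooth projective family `g : 𝒴 ⟶ T` of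
smooth `2p`-dimensional degree-`d` hypersurfaces over a smooth irreducible QUASI-PROJECTIVE base (`𝒴`, `T`
quasi-projective, so that the countability theorem of stub 3 applies verbatim), points `t₁ t₂`, an iso
`e₂ : 𝒴_{t₂} ≅ X` and a global class `Θ ∈ H²ᵖ(𝒴(ℂ);ℂ)`, fibrewise rational of type `(p,p)`, with `Θ|_{t₂} = e₂^* ζ`,
such that the fibre `𝒴_{t₁}` is NOT isomorphic to `X` and `Θ|_{t₁}` is ALGEBRAIC. Why plausibly true: implied by HC
(restrict the movable datum's family to a smooth irreducible curve through `s` and a non-isomorphic fibre); intended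
sources of anchors: the family over (a resolution of the smooth locus of) the normalised Hodge-locus component `Z̄'` of
`ζ` (Cattani–Deligne–Kaplan + theorem of the fixed part, as in `birth` stub 1) and on it a member where `ζ` is KNOWN
algebraic — Fermat members (Shioda 1979; tree fact `hodgeClasses_algebraic_fermat`), members containing a linear `ℙᵖ`
or a complete intersection of codimension `p` (Otwinowska 2003, Dan 2014, Kloosterman 2021: components of small
codimension ARE such flag loci), CM members, or the nearby fibre of a supported nodal degeneration (`birth` stubs 1+2).
Why it might fail: a movable component need not contain any member with known HC — thickenings `F(x) + G(u,v)` of a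
rigid pair `(V(F), ξ)` with `ξ` not known algebraic (e.g. Aoki classes on Fermat `X^{2p-2}_m`, `m` composite) move only
through members containing the rigid seed (census §Negation); and it asks HC-type input on factor components
(Klingler–Otwinowska–Urbanik 2023, Def. 1.10). Size: XL (open; the crux's geography).
[cite: CattaniDeligneKaplan1995, Thm 1.1] [cite: Shioda1979HodgeFermat, Thm I–II] [cite: Kloosterman2025, Thm 1.1] -/
def AnchorOnHodgeLocusFamily : Prop :=
  ∀ (p d : ℕ) (X : Literature.AlgebraicGeometry.Motives.SchemeOver ℂ)
    (ζ : Literature.AlgebraicGeometry.HodgeTheory.complexBetti X (2 * p)),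
    Literature.AlgebraicGeometry.Motives.IsSmoothHypersurface (2 * p) d X →
    Literature.AlgebraicGeometry.HodgeTheory.IsRationalClass ζ →
    Literature.AlgebraicGeometry.HodgeTheory.IsOfHodgeType (2 * p) X (2 * p) p p ζ →
    (∃ (S 𝒳 : Literature.AlgebraicGeometry.Motives.SchemeOver ℂ) (f : 𝒳 ⟶ S) (s : Literature.AlgebraicGeometry.Motives.ComplexPoints S) (e : Literature.AlgebraicGeometry.Motives.fiberOver f s ≅ X) (Ξ : Literature.AlgebraicGeometry.HodgeTheory.complexBetti 𝒳 (2 * p)), Literature.AlgebraicGeometry.Motives.IsSmoothProjectiveFamily f (2 * p) ∧ AlgebraicGeometry.LocallyOfFiniteType S.hom ∧ IrreducibleSpace S.left ∧ (∀ t : Literature.AlgebraicGeometry.Motives.ComplexPoints S, Literature.AlgebraicGeometry.Motives.IsSmoothHypersurface (2 * p) d (Literature.AlgebraicGeometry.Motives.fiberOver f t)) ∧ (∃ t : Literature.AlgebraicGeometry.Motives.ComplexPoints S, IsEmpty (Literature.AlgebraicGeometry.Motives.fiberOver f t ≅ Literature.AlgebraicGeometry.Motives.fiberOver f s)) ∧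 Literature.AlgebraicGeometry.HodgeTheory.IsRationalClass Ξ ∧ (∀ t : Literature.AlgebraicGeometry.Motives.ComplexPoints S, Literature.AlgebraicGeometry.HodgeTheory.IsOfHodgeType (2 * p) (Literature.AlgebraicGeometry.Motives.fiberOver f t) (2 * p) p p ((Literature.AlgebraicGeometry.HodgeTheory.complexBetti.map (Literature.AlgebraicGeometry.Motives.fiberι f t) (2 * p)).hom Ξ)) ∧ (Literature.AlgebraicGeometry.HodgeTheory.complexBetti.map (Literature.AlgebraicGeometry.Motives.fiberι f s) (2 * p)).hom Ξ = (Literature.AlgebraicGeometry.HodgeTheory.complexBetti.map e.hom (2 * p)).hom ζ) →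
    ∃ (𝒴 T : Literature.AlgebraicGeometry.Motives.SchemeOver ℂ) (g : 𝒴 ⟶ T)
      (t₁ t₂ : Literature.AlgebraicGeometry.Motives.ComplexPoints T)
      (e₂ : Literature.AlgebraicGeometry.Motives.fiberOver g t₂ ≅ X)
      (Θ : Literature.AlgebraicGeometry.HodgeTheory.complexBetti 𝒴 (2 * p)),
      Literature.AlgebraicGeometry.Motives.IsSmoothProjectiveFamily g (2 * p) ∧
      IrreducibleSpace T.left ∧ AlgebraicGeometry.Smooth T.hom ∧
      Literature.AlgebraicGeometry.HodgeTheory.IsQuasiProjectiveOver 𝒴 ∧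
      Literature.AlgebraicGeometry.HodgeTheory.IsQuasiProjectiveOver T ∧
      (∀ s : Literature.AlgebraicGeometry.Motives.ComplexPoints T,
        Literature.AlgebraicGeometry.Motives.IsSmoothHypersurface (2 * p) d
          (Literature.AlgebraicGeometry.Motives.fiberOver g s)) ∧
      (∀ s : Literature.AlgebraicGeometry.Motives.ComplexPoints T,
        Literature.AlgebraicGeometry.HodgeTheory.IsRationalClass
            (Literature.AlgebraicGeometry.HodgeTheory.complexBetti.map
              (Literature.AlgebraicGeometry.Motives.fiberι g s) (2 * p) Θ) ∧
          Literature.AlgebraicGeometry.HodgeTheory.IsOfHodgeType (2 * p)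
            (Literature.AlgebraicGeometry.Motives.fiberOver g s) (2 * p) p p
            (Literature.AlgebraicGeometry.HodgeTheory.complexBetti.map
              (Literature.AlgebraicGeometry.Motives.fiberι g s) (2 * p) Θ)) ∧
      Literature.AlgebraicGeometry.HodgeTheory.complexBetti.map
          (Literature.AlgebraicGeometry.Motives.fiberι g t₂) (2 * p) Θ =
        Literature.AlgebraicGeometry.HodgeTheory.complexBetti.map e₂.hom (2 * p) ζ ∧
      IsEmpty (Literature.AlgebraicGeometry.Motives.fiberOver g t₁ ≅ X) ∧
      Literature.AlgebraicGeometry.HodgeTheory.complexBetti.map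
          (Literature.AlgebraicGeometry.Motives.fiberι g t₁) (2 * p) Θ ∈
        Literature.AlgebraicGeometry.HodgeTheory.algebraicClasses
          (Literature.AlgebraicGeometry.Motives.fiberOver g t₁) p

/-- **Statement of stub 2 — LOCAL variational Hodge for hypersurface families.** For a smooth projective family
`g : 𝒴 ⟶ T` of smooth `2p`-dimensional degree-`d` hypersurfaces over a smooth irreducible base and a global class
`Θ ∈ H²ᵖ(𝒴(ℂ);ℂ)` that is rational of type `(p,p)` on every fibre (the family lies in the Hodge locus of `Θ`): if
`Θ|_{t₁}` is algebraic, then `Θ|_t` is algebraic for all `t` in some analytic-open neighbourhood of `t₁`. Why plausibly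
true: it is Grothendieck's variational Hodge statement in its original LOCAL form (Grothendieck 1966 footnote 13;
Charles–Schnell Conj. 11.3.1), implied by HC and by the global form `Birth.PropagationAlongHodgeLocus` (`N = univ`,
proved below), equal in content to the `k = 0` case of the route's `ReturnAlongHodgeLocus` (stmt-13854); a THEOREM when
`Θ|_{t₁}` is the Chern character of a semiregular sheaf or the class of a semiregular lci / complete-intersection
subvariety (Bloch 1972 Thm 7.3; Buchweitz–Flenner 2003 Thm 5.1, tree fact
`BuchweitzFlenner2003_variationalHodge_semiregular`; Dan 2014; Kloosterman 2021), and formally true in general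
(Bloch–Esnault–Kerz 2014 Thm 1.3: the obstruction to a formal lift of the K-class vanishes iff the class stays Hodge).
Why it might fail: as a statement only with HC; as a strategy it stalls on the algebraisation of formal lifts for
non-semiregular anchors and on non-reduced Hodge loci (Dan; Duque Franco–Villaflor 2023 fake linear cycles). Size: XL
(open in general; L for semiregular anchors given the tree facts). [cite: Bloch1972Semiregularity, Thm 7.3]
[cite: BuchweitzFlenner2003, Thm 5.1] [cite: BlochEsnaultKerz2014CharZero, Thm 1.3] [cite: CharlesSchnell2014Notes, Conj. 11.3.1] -/
def LocalVariationalHodge : Prop :=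
  ∀ (p d : ℕ) (𝒴 T : Literature.AlgebraicGeometry.Motives.SchemeOver ℂ) (g : 𝒴 ⟶ T),
    Literature.AlgebraicGeometry.Motives.IsSmoothProjectiveFamily g (2 * p) →
    IrreducibleSpace T.left → AlgebraicGeometry.Smooth T.hom →
    (∀ s : Literature.AlgebraicGeometry.Motives.ComplexPoints T,
      Literature.AlgebraicGeometry.Motives.IsSmoothHypersurface (2 * p) d
        (Literature.AlgebraicGeometry.Motives.fiberOver g s)) →
    ∀ (Θ : Literature.AlgebraicGeometry.HodgeTheory.complexBetti 𝒴 (2 * p)),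
      (∀ s : Literature.AlgebraicGeometry.Motives.ComplexPoints T,
        Literature.AlgebraicGeometry.HodgeTheory.IsRationalClass
            (Literature.AlgebraicGeometry.HodgeTheory.complexBetti.map
              (Literature.AlgebraicGeometry.Motives.fiberι g s) (2 * p) Θ) ∧
          Literature.AlgebraicGeometry.HodgeTheory.IsOfHodgeType (2 * p)
            (Literature.AlgebraicGeometry.Motives.fiberOver g s) (2 * p) p p
            (Literature.AlgebraicGeometry.HodgeTheory.complexBetti.map
              (Literature.AlgebraicGeometry.Motives.fiberι g s) (2 * p) Θ)) →
      ∀ t₁ : Literature.AlgebraicGeometry.Motives.ComplexPoints T,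
        Literature.AlgebraicGeometry.HodgeTheory.complexBetti.map
            (Literature.AlgebraicGeometry.Motives.fiberι g t₁) (2 * p) Θ ∈
          Literature.AlgebraicGeometry.HodgeTheory.algebraicClasses
            (Literature.AlgebraicGeometry.Motives.fiberOver g t₁) p →
        ∃ N : _root_.Set (Literature.AlgebraicGeometry.Motives.ComplexPoints T), IsOpen N ∧ t₁ ∈ N ∧
          ∀ t ∈ N, Literature.AlgebraicGeometry.HodgeTheory.complexBetti.map
              (Literature.AlgebraicGeometry.Motives.fiberι g t) (2 * p) Θ ∈
            Literature.AlgebraicGeometry.HodgeTheory.algebraicClasses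
              (Literature.AlgebraicGeometry.Motives.fiberOver g t) p

/-- **Statement of stub 3 — an open set of algebraic fibres propagates to every fibre (KNOWN).** For a smooth
projective family `g : 𝒴 ⟶ T` of relative dimension `n` with `𝒴`, `T` quasi-projective and `T` smooth irreducible,
and ANY global class `Θ ∈ H²ᵖ(𝒴(ℂ);ℂ)`: if `Θ|_t` is algebraic for all `t` in a non-empty analytic-open `N ⊆ T(ℂ)`,
then `Θ|_t` is algebraic for every `t`. Proof in print: the algebraicity locus `{t | Θ|_t ∈ Nᵖ}` equals `⋃_j W_j(ℂ)`
for countably many Zariski-closed `W_j ⊆ T` (relative Hilbert schemes are proper with countably many components: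
Charles–Schnell 2014, proof of Prop. 11.3.11; Voisin, Hodge Theory II §3.3.1 and proof of Thm 7.19; = the tree's named
fact `charlesSchnell_algebraicityLocus_iUnion_closed`, whose hypotheses are exactly the ones listed); `N` is a Baire
space covered by the closed sets `N ∩ W_j(ℂ)`, so some `W_j(ℂ)` has non-empty analytic interior; a Zariski-closed
subset of the irreducible `T` with non-empty analytic interior is all of `T` (dimension). No rationality / Hodge-type
hypothesis is needed. Why it might fail: it does not (theorem); formalisation debt only (the named fact is unproved in
the tree; Baire category on `ComplexPoints T`; empty interior of proper closed subvarieties). Size: L.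
[cite: CharlesSchnell2014Notes, Prop. 11.3.11 (proof)] [cite: VoisinHodgeII2003, §3.3.1 and §7.3.2] -/
def OpenAnchorPropagates : Prop :=
  ∀ (n p : ℕ) (𝒴 T : Literature.AlgebraicGeometry.Motives.SchemeOver ℂ) (g : 𝒴 ⟶ T),
    Literature.AlgebraicGeometry.Motives.IsSmoothProjectiveFamily g n →
    IrreducibleSpace T.left → AlgebraicGeometry.Smooth T.hom →
    Literature.AlgebraicGeometry.HodgeTheory.IsQuasiProjectiveOver 𝒴 →
    Literature.AlgebraicGeometry.HodgeTheory.IsQuasiProjectiveOver T →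
    ∀ (Θ : Literature.AlgebraicGeometry.HodgeTheory.complexBetti 𝒴 (2 * p))
      (N : _root_.Set (Literature.AlgebraicGeometry.Motives.ComplexPoints T)), IsOpen N → N.Nonempty →
      (∀ t ∈ N, Literature.AlgebraicGeometry.HodgeTheory.complexBetti.map
          (Literature.AlgebraicGeometry.Motives.fiberι g t) (2 * p) Θ ∈
        Literature.AlgebraicGeometry.HodgeTheory.algebraicClasses
          (Literature.AlgebraicGeometry.Motives.fiberOver g t) p) →
      ∀ t : Literature.AlgebraicGeometry.Motives.ComplexPoints T,
        Literature.AlgebraicGeometry.HodgeTheory.complexBetti.map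
            (Literature.AlgebraicGeometry.Motives.fiberι g t) (2 * p) Θ ∈
          Literature.AlgebraicGeometry.HodgeTheory.algebraicClasses
            (Literature.AlgebraicGeometry.Motives.fiberOver g t) p

/-! ## §2 The three registered stubs (`sorry` lives ONLY here) -/

/-- **Stub 1** — `AnchorOnHodgeLocusFamily` (statement, mechanism, risks and sources in its docstring above). The
HARDEST stub: the crux's anchor geography. [cite: CattaniDeligneKaplan1995, Thm 1.1] -/
theorem stub_anchorOnHodgeLocusFamily : AnchorOnHodgeLocusFamily := by
  sorry

/-- **Stub 2** — `LocalVariationalHodge` (local VHC for hypersurface families; docstring above).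
[cite: Bloch1972Semiregularity, Thm 7.3] [cite: BuchweitzFlenner2003, Thm 5.1] -/
theorem stub_localVariationalHodge : LocalVariationalHodge := by
  sorry

/-- **Stub 3** — `OpenAnchorPropagates` (known: countability of the algebraicity locus + Baire; docstring above).
[cite: CharlesSchnell2014Notes, Prop. 11.3.11 (proof)] -/
theorem stub_openAnchorPropagates : OpenAnchorPropagates := by
  sorry

/-! ## §3 The composition: the three stubs prove the crux BY NAME (sorry-free) -/

/-- **THE SKELETON THEOREM** (`stub₁-sig → stub₂-sig → stub₃-sig → crux`, conclusion = the route decl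
`…Theses.IncidenceNodePeeling.HCMovablePairs` BY NAME). Real proof: stub 1 gives the family `(g, Θ, t₁, t₂, e₂)` with
the anchor at `t₁`; stub 2 turns the anchor into an open set `N ∋ t₁` of algebraic fibres; stub 3 propagates to every
fibre, in particular `t₂`; finally `Θ|_{t₂} = e₂^* ζ` and transport across `e₂ : 𝒴_{t₂} ≅ X`. [folklore] -/
theorem HCMovablePairs_of :
    AnchorOnHodgeLocusFamily → LocalVariationalHodge → OpenAnchorPropagates →
    Summit.HodgeConjecture.HodgeConjecture.Theses.IncidenceNodePeeling.HCMovablePairs := by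
  intro hA hB hC p d X ζ hX hq hpp hmov
  unfold AnchorOnHodgeLocusFamily at hA
  unfold LocalVariationalHodge at hB
  unfold OpenAnchorPropagates at hC
  obtain ⟨𝒴, T, g, t₁, t₂, e₂, Θ, hg, hirr, hsm, hq𝒴, hqT, hhyp, hΘ, hΘζ, -, hanchor⟩ :=
    hA p d X ζ hX hq hpp hmov
  -- LOCAL VHC at the anchor `t₁`: an open set of algebraic fibres
  obtain ⟨N, hNopen, ht₁, hN⟩ := hB p d 𝒴 T g hg hirr hsm hhyp Θ hΘ t₁ hanchor
  -- PROPAGATION (countability + Baire) to every fibre, in particular `t₂`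
  have h₃ := hC (2 * p) p 𝒴 T g hg hirr hsm hq𝒴 hqT Θ N hNopen ⟨t₁, ht₁⟩ hN t₂
  rw [hΘζ] at h₃
  -- across `e₂ : 𝒴_{t₂} ≅ X`
  exact (Literature.AlgebraicGeometry.HodgeTheory.mem_algebraicClasses_map_iff_of_iso e₂).1 h₃

/-- **Registered target of the skeleton** — the crux BY NAME with NO hypotheses (`sorryAx` is reached exactly through
the three `stub_*`; closes nothing until they land). -/
theorem HCMovablePairs_of_stubs :
    Summit.HodgeConjecture.HodgeConjecture.Theses.IncidenceNodePeeling.HCMovablePairs :=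
  HCMovablePairs_of stub_anchorOnHodgeLocusFamily stub_localVariationalHodge stub_openAnchorPropagates

/-! ## §4 Recorded relations (sorry-free): where the stubs sit relative to `birth` and to the summit -/

/-- `birth`'s stub 3 (GLOBAL propagation along hypersurface families) implies stub 2 (LOCAL form): take `N = univ`.
So this line's propagation input is WEAKER than `birth`'s. [folklore] -/
theorem localVariationalHodge_of_propagationAlongHodgeLocus
    (h : ∀ (p d : ℕ) (𝒴 T : Literature.AlgebraicGeometry.Motives.SchemeOver ℂ) (g : 𝒴 ⟶ T),
      Literature.AlgebraicGeometry.Motives.IsSmoothProjectiveFamily g (2 * p) →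
      IrreducibleSpace T.left → AlgebraicGeometry.Smooth T.hom →
      (∀ s : Literature.AlgebraicGeometry.Motives.ComplexPoints T,
        Literature.AlgebraicGeometry.Motives.IsSmoothHypersurface (2 * p) d
          (Literature.AlgebraicGeometry.Motives.fiberOver g s)) →
      ∀ (Θ : Literature.AlgebraicGeometry.HodgeTheory.complexBetti 𝒴 (2 * p)),
        (∀ s : Literature.AlgebraicGeometry.Motives.ComplexPoints T,
          Literature.AlgebraicGeometry.HodgeTheory.IsRationalClass
              (Literature.AlgebraicGeometry.HodgeTheory.complexBetti.map
                (Literature.AlgebraicGeometry.Motives.fiberι g s) (2 * p) Θ) ∧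
            Literature.AlgebraicGeometry.HodgeTheory.IsOfHodgeType (2 * p)
              (Literature.AlgebraicGeometry.Motives.fiberOver g s) (2 * p) p p
              (Literature.AlgebraicGeometry.HodgeTheory.complexBetti.map
                (Literature.AlgebraicGeometry.Motives.fiberι g s) (2 * p) Θ)) →
        (∃ s₀ : Literature.AlgebraicGeometry.Motives.ComplexPoints T,
          Literature.AlgebraicGeometry.HodgeTheory.complexBetti.map
              (Literature.AlgebraicGeometry.Motives.fiberι g s₀) (2 * p) Θ ∈
            Literature.AlgebraicGeometry.HodgeTheory.algebraicClasses
              (Literature.AlgebraicGeometry.Motives.fiberOver g s₀) p) →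
        ∀ s : Literature.AlgebraicGeometry.Motives.ComplexPoints T,
          Literature.AlgebraicGeometry.HodgeTheory.complexBetti.map
              (Literature.AlgebraicGeometry.Motives.fiberι g s) (2 * p) Θ ∈
            Literature.AlgebraicGeometry.HodgeTheory.algebraicClasses
              (Literature.AlgebraicGeometry.Motives.fiberOver g s) p) :
    LocalVariationalHodge :=
  fun p d 𝒴 T g hg hirr hsm hhyp Θ hΘ t₁ ht₁ =>
    ⟨_root_.Set.univ, isOpen_univ, _root_.Set.mem_univ _,
      fun t _ => h p d 𝒴 T g hg hirr hsm hhyp Θ hΘ ⟨t₁, ht₁⟩ t⟩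

/-- `S → stub 2` (recorded converse probe): stub 2 is a CONSEQUENCE of the summit, fibrewise (the anchor, the base
hypotheses and the neighbourhood unused: `N = univ`). [folklore] -/
theorem localVariationalHodge_of_hodgeConjecture (h : _root_.HodgeConjecture) : LocalVariationalHodge :=
  fun p _d _𝒴 _T g _ _ _ hhyp Θ hΘ t₁ _ =>
    ⟨_root_.Set.univ, isOpen_univ, _root_.Set.mem_univ _, fun s _ => (h (hhyp s).1).2 p _ (hΘ s).1 (hΘ s).2⟩

/-- `S → crux` (recorded converse probe, as in `birth`): the crux is a consequence of the summit. [folklore] -/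
example (h : _root_.HodgeConjecture) :
    Summit.HodgeConjecture.HodgeConjecture.Theses.IncidenceNodePeeling.HCMovablePairs :=
  fun p _d _X ζ hX hq hpp _ => (h hX.1).2 p ζ hq hpp

end Summit.HodgeConjecture.HodgeConjecture.Cruxes.HCMovablePairs.LocalAnchor
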